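import Literature.AlgebraicGeometry.Frobenioids.ArithmeticFrobenioidThm64ivGaloisConjugate
import Literature.AlgebraicGeometry.Frobenioids.ArithmeticFrobenioidThm64ivSolitaryCor411
import Literature.AlgebraicGeometry.Frobenioids.ArithmeticFrobenioidThm64ivConjOfRigidity
import HarnessLib

/-!
# Frobenioids I, Thm. 6.4 (iv), second clause AT THE DATA for EVERY base field `F₁`: the real-place case and
# the typed Cor. 4.11 (iv) node

Mochizuki, *The geometry of Frobenioids I: the general theory*, Kyushu J. Math. **62** (2008) 293–400, §6,
Thm. 6.4 (iv) p. 115 l. 17–29 ("the corresponding `L₂` is isomorphic to `L₁` in a fashion that is compatible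
with an isomorphism `F₁ ⥲ F₂`") [cite: MochizukiFrdI2008, Thm. 6.4 (iv) p.115].

PROOF-ONLY file (cell abc-iut, GAP-LEDGER row G-L1t3-1 #2; seat abc-iut-w4-d090, row holder).  abc-iut-L1-d3's
`Thm64iv_arith_compat_of_faithful` proves the printed clause at the Cor. 4.11 (iv) datum for EVERY number field
`F₁`, at every `X = Spec L₁` (`L₁` Galois over `ℚ`) on whose infinite places `Gal(L₁/ℚ)` acts faithfully.  Here:
* `Thm64iv_arith_compat_of_isReal` — the faithfulness holds whenever `L₁` has a REAL place (the stabiliser of a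
  real place in `Gal(L₁/ℚ)` is trivial: `forall_smul_eq_imp_eq_one_of_isReal`), so the clause holds at every
  such `X` for every `F₁`; `nonempty_baseRingEquiv_arith_of_isReal` — hence `F₁ ≅ F₂`;
* `Thm64iv_compat_of_cor411iv_of_faithful` / `Thm64iv_compat_of_cor411iv_of_isReal` — the same over the typed node
  `PreFrobenioidData.Cor411iv` for `Ψ` (rationally standard parameters of Thm. 6.4 (i)), binder-free.
Residual case of row G-L1t3-1 #2 after this file: `X.L` totally complex with `Gal(X.L/ℚ)` acting non-faithfully on
the infinite places (central complex conjugation, `X.L` CM).  No definitions, no named facts; nothing here bears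
on [IUTchIII] Cor. 3.12 or asserts anything about abc.
-/

noncomputable section

namespace Literature.AlgebraicGeometry.Frobenioids

open CategoryTheory NumberField

section Arith

variable {F₁ : Type} [Field F₁] [NumberField F₁] {K₁ : Type} [Field K₁] [Algebra F₁ K₁] [IsGalois F₁ K₁]
variable {F₂ : Type} [Field F₂] [NumberField F₂] {K₂ : Type} [Field K₂] [Algebra F₂ K₂] [IsGalois F₂ K₂]

/-- **[FrdI] Thm. 6.4 (iv), second clause AT THE DATA, for EVERY number field `F₁`, at every `X = Spec L₁` with
`L₁` Galois over `ℚ` having a REAL place**: for an equivalence `Ψ : C_{K₁/F₁} ⥲ C_{K₂/F₂}` of THE arithmetic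
Frobenioids with Cor. 4.11 (iv) datum `(Ψ^Base, Ψ^Φ = E, η, hdiv)`, `L₂ := (Ψ^Base X).L ≅ L₁` compatibly with an
isomorphism `F₁ ≅ F₂` (abc-iut-L1-d3's `Thm64iv_arith_compat_of_faithful`; faithfulness from the real place).
[cite: MochizukiFrdI2008, Thm. 6.4 (iv) p.115] -/
theorem Thm64iv_arith_compat_of_isReal (Ψ : arithFrobenioid F₁ K₁ ≌ arithFrobenioid F₂ K₂)
    {ΨBase : FinSubextCat F₁ K₁ ⥤ FinSubextCat F₂ K₂} [ΨBase.IsEquivalence]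
    (E : PreFrobenioidData.DivisorMonoidIsoOverBase (arithFrobenioidOps F₁ K₁) (arithFrobenioidOps F₂ K₂) ΨBase)
    (η : Ψ.functor ⋙ (arithFrobenioidOps F₂ K₂).base ≅ (arithFrobenioidOps F₁ K₁).base ⋙ ΨBase)
    (hdiv : ∀ ⦃A B : arithFrobenioid F₁ K₁⦄ (φ : A ⟶ B),
      (arithFrobenioidOps F₂ K₂).div (Ψ.functor.map φ) =
        (arithFrobenioidOps F₂ K₂).pull (η.hom.app A)
          (E.iso ((arithFrobenioidOps F₁ K₁).base.obj A) ((arithFrobenioidOps F₁ K₁).div φ)))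
    (X : FinSubextCat F₁ K₁) (hX : IsGalois ℚ X.L) {v₀ : InfinitePlace X.L} (hv₀ : v₀.IsReal) :
    ∃ (e : X.L ≃+* (ΨBase.obj X).L) (e₀ : F₁ ≃+* F₂),
      ∀ a : F₁, e (algebraMap F₁ X.L a) = algebraMap F₂ (ΨBase.obj X).L (e₀ a) :=
  Thm64iv_arith_compat_of_faithful Ψ E η hdiv X hX
    fun g hg => forall_smul_eq_imp_eq_one_of_isReal hv₀ g hg

/-- **`F₁ ≅ F₂`** whenever some `X = Spec L₁` of `D₁` has `L₁` Galois over `ℚ` with a real place — for EVERY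
number field `F₁`. [cite: MochizukiFrdI2008, Thm. 6.4 (iv) p.115] -/
theorem nonempty_baseRingEquiv_arith_of_isReal (Ψ : arithFrobenioid F₁ K₁ ≌ arithFrobenioid F₂ K₂)
    {ΨBase : FinSubextCat F₁ K₁ ⥤ FinSubextCat F₂ K₂} [ΨBase.IsEquivalence]
    (E : PreFrobenioidData.DivisorMonoidIsoOverBase (arithFrobenioidOps F₁ K₁) (arithFrobenioidOps F₂ K₂) ΨBase)
    (η : Ψ.functor ⋙ (arithFrobenioidOps F₂ K₂).base ≅ (arithFrobenioidOps F₁ K₁).base ⋙ ΨBase)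
    (hdiv : ∀ ⦃A B : arithFrobenioid F₁ K₁⦄ (φ : A ⟶ B),
      (arithFrobenioidOps F₂ K₂).div (Ψ.functor.map φ) =
        (arithFrobenioidOps F₂ K₂).pull (η.hom.app A)
          (E.iso ((arithFrobenioidOps F₁ K₁).base.obj A) ((arithFrobenioidOps F₁ K₁).div φ)))
    (X : FinSubextCat F₁ K₁) (hX : IsGalois ℚ X.L) {v₀ : InfinitePlace X.L} (hv₀ : v₀.IsReal) :
    Nonempty (F₁ ≃+* F₂) := by
  obtain ⟨-, e₀, -⟩ := Thm64iv_arith_compat_of_isReal Ψ E η hdiv X hX hv₀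
  exact ⟨e₀⟩

/-- **Over the typed [FrdI] Cor. 4.11 (iv) node** (`PreFrobenioidData.Cor411iv` for `Ψ`, with the rationally
standard parameters of Thm. 6.4 (i)): the printed clause at every `X` with `X.L` Galois over `ℚ` on whose
infinite places `Gal(X.L/ℚ)` acts faithfully, for EVERY number field `F₁`. [cite: MochizukiFrdI2008, Thm. 6.4 (iv) p.115] -/
theorem Thm64iv_compat_of_cor411iv_of_faithful (Ψ : arithFrobenioid F₁ K₁ ≌ arithFrobenioid F₂ K₂)
    (h411iv : PreFrobenioidData.Cor411iv (arithFrobenioidOps F₁ K₁) (arithFrobenioidOps F₂ K₂) Ψ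
      (PreFrobenioid.rsParams (arithFrobenioid_isFrobenioid F₁ K₁) fun a 𝔭 => PrimarySupp a 𝔭)
      (PreFrobenioid.rsParams (arithFrobenioid_isFrobenioid F₂ K₂) fun a 𝔭 => PrimarySupp a 𝔭))
    (X : FinSubextCat F₁ K₁) (hX : IsGalois ℚ X.L)
    (hfaith : ∀ g : X.L ≃ₐ[ℚ] X.L, (∀ v : InfinitePlace X.L, g • v = v) → g = 1) :
    ∃ (ΨBase : FinSubextCat F₁ K₁ ⥤ FinSubextCat F₂ K₂) (e : X.L ≃+* (ΨBase.obj X).L) (e₀ : F₁ ≃+* F₂),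
      ∀ a : F₁, e (algebraMap F₁ X.L a) = algebraMap F₂ (ΨBase.obj X).L (e₀ a) := by
  obtain ⟨ΨBase, E, η, hEq, -, hdiv, -⟩ :=
    h411iv (cor411Setting_arith F₁ K₁ F₂ K₂ Ψ) (Thm64i_frobenioid_rsParams F₁ K₁).2.1
      (Thm64i_frobenioid_rsParams F₂ K₂).2.1
  haveI := hEq
  exact ⟨ΨBase, Thm64iv_arith_compat_of_faithful Ψ E η hdiv X hX hfaith⟩

/-- **Over the typed [FrdI] Cor. 4.11 (iv) node**, real-place case: the printed clause at every `X` with `X.L`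
Galois over `ℚ` having a real place, for EVERY number field `F₁`. [cite: MochizukiFrdI2008, Thm. 6.4 (iv) p.115] -/
theorem Thm64iv_compat_of_cor411iv_of_isReal (Ψ : arithFrobenioid F₁ K₁ ≌ arithFrobenioid F₂ K₂)
    (h411iv : PreFrobenioidData.Cor411iv (arithFrobenioidOps F₁ K₁) (arithFrobenioidOps F₂ K₂) Ψ
      (PreFrobenioid.rsParams (arithFrobenioid_isFrobenioid F₁ K₁) fun a 𝔭 => PrimarySupp a 𝔭)
      (PreFrobenioid.rsParams (arithFrobenioid_isFrobenioid F₂ K₂) fun a 𝔭 => PrimarySupp a 𝔭))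
    (X : FinSubextCat F₁ K₁) (hX : IsGalois ℚ X.L) {v₀ : InfinitePlace X.L} (hv₀ : v₀.IsReal) :
    ∃ (ΨBase : FinSubextCat F₁ K₁ ⥤ FinSubextCat F₂ K₂) (e : X.L ≃+* (ΨBase.obj X).L) (e₀ : F₁ ≃+* F₂),
      ∀ a : F₁, e (algebraMap F₁ X.L a) = algebraMap F₂ (ΨBase.obj X).L (e₀ a) :=
  Thm64iv_compat_of_cor411iv_of_faithful Ψ h411iv X hX
    fun g hg => forall_smul_eq_imp_eq_one_of_isReal hv₀ g hg

/-- **`F₁ ≅ F₂` over the typed node**, real-place case. [cite: MochizukiFrdI2008, Thm. 6.4 (iv) p.115] -/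
theorem nonempty_baseRingEquiv_of_cor411iv_of_isReal (Ψ : arithFrobenioid F₁ K₁ ≌ arithFrobenioid F₂ K₂)
    (h411iv : PreFrobenioidData.Cor411iv (arithFrobenioidOps F₁ K₁) (arithFrobenioidOps F₂ K₂) Ψ
      (PreFrobenioid.rsParams (arithFrobenioid_isFrobenioid F₁ K₁) fun a 𝔭 => PrimarySupp a 𝔭)
      (PreFrobenioid.rsParams (arithFrobenioid_isFrobenioid F₂ K₂) fun a 𝔭 => PrimarySupp a 𝔭))
    (X : FinSubextCat F₁ K₁) (hX : IsGalois ℚ X.L) {v₀ : InfinitePlace X.L} (hv₀ : v₀.IsReal) :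
    Nonempty (F₁ ≃+* F₂) := by
  obtain ⟨-, -, e₀, -⟩ := Thm64iv_compat_of_cor411iv_of_isReal Ψ h411iv X hX hv₀
  exact ⟨e₀⟩

end Arith

end Literature.AlgebraicGeometry.Frobenioids

end
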